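import Summits.QuantumFields.YangMills.Theorems.FluctuationComparisonRegPrIntLS2BetaChartReadBkgLipschitz
import Summits.QuantumFields.YangMills.Theorems.FluctuationComparisonRegPrIntLS2BetaChartReadGaugeCovariance
import Summits.QuantumFields.YangMills.Theorems.BalabanUVNodesN18CombStepAxialGauge
import Literature.MathematicalPhysics.QuantumFieldTheory.Balaban1983to89.T4AxialGaugeSmallField
import HarnessLib

/-!
# S2β · (β-3)′ FILE C₄ — DOOR (α) DOCKED: (β-3)′ AT A PLAQUETTE-SMALL BACKGROUND WITH NO GAUGE HYPOTHESIS.  The two-block AXIAL GAUGE `h` of lit ✓`T4AxialGaugeSmallField`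
# puts a `PlaqSmall δ` background within `κ = (d−1)·2L·δ` of `1` on every bond issuing from `B(c₋) ∪ B(c₊)`; C₃ says the second-order remainder's norm is gauge invariant; so C₂ gives
# `‖↑(ψ_{U₀}(X)c) − ↑((Dψ_{U₀}(0)X)c)‖ ≤ 8B·OSC_h²∕(a−‖A‖)² + 32B·OSC_h·‖A‖∕a² + (ℓ‖A‖)³ + 8·(67ℓ·((d−1)·2L·δ))·‖X‖²∕a²`, `OSC_h = ‖Ad_h X − A∘dir‖`

Cell `ym3-torus` (YM ladder rung R3 = continuum `SU(2)` Yang–Mills on the three-torus at fixed lattice data — a RUNG: NOT d = 4, NOT infinite volume, NOT a mass gap,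
NOT Clay).  Width seat `ym3-torus-px13` (gen 28); crux `stmt-QuantumFields-20520`, LINE g18-1 S2β, pairing lane; (SCT″-c)₁ source side ∕ (β-3)′ (ARCHITECT RULING px17 g22 19:55:50Z);
the ARCHITECT's consumer doors of the curved (β-3)′ (21:38:47Z): (α) AX-LOC, (β) COV, (γ) OSC-GAUGE.  (β)(γ) are C₃ ✓p835880; THIS FILE docks (α) for the chart-read remainder:
the construction is LANDED Literature (✓`T4AxialGaugeSmallField.axialGauge`, its torus non-abelian Poincaré lemma ★`dist1_gaugeAct_axialGauge_le_of_mem_boxBonds`: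
`PlaqSmallOn` of a non-wrapping integer box ⟹ `dist1 ≤ (d−1)·n·δ` on the box bonds), and the one junction — the bonds issuing from the block pair ARE box bonds of the
`(2L+1)`-box `[emb c₋ − h, emb c₋ + h + L·e_μ + 1]`, `h = (L−1)∕2` — is N18 ✓`inBox_rel_of_twoBlock` read through lit ✓`transl_rel` (`castSite (emb c₋ + rel) = b₋`).
`--kind proof --supports stmt-QuantumFields-20520 --as helper`, count-neutral, DEFINITION-FREE (0 `def`, 0 `instance`, 0 `notation`, 0 `sorry`, default heartbeats); generic `P : Params`
(`j + 2 ≤ m + K`), `SU(N)`.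

WHAT IS PROVED (sorry-free; `ℓ = (d+2)L`; the axial gauge and the conjugated direction `(Ad_h X)_b = ⟨h(b₋)·↑X_b·h(b₋)⋆, conj_mem_lie⟩` are written out as terms).
§1 ★`mem_boxBonds_of_blockOf_src` (two-block bonds are box bonds), `hi_le_lo_add` (`hi ≤ lo + 2L`), `two_mul_lt_sitesPerDir` (`2L < sitesPerDir j`, no wrap), ★★`norm_coe_gaugeAct_axialGauge_sub_one_le`
   (**`‖(h•U₀)(b) − 1‖ ≤ (d−1)·2L·δ`** on the bonds issuing from `B(c₋) ∪ B(c₊)`, from `PlaqSmall δ U₀` alone — C₂'s LOCAL letter `hκ` DISCHARGED, `κ = (d−1)·2L·δ`).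
§2 ★★★**`norm_chartRead_sub_fderiv_le_of_plaqSmall`** — hypotheses: global loop guard `∀ c i, dist1 (loopHol U₀ c i) ≤ α`, `4α ≤ ρ ≤ innerRadius`, `0 < ρ`; `PlaqSmall δ U₀`, `0 ≤ δ`,
   `100ℓ·((d−1)·2L·δ) ≤ ρ`; radius `0 < a`, `100ℓ(e^a − 1) ≤ ρ`; `A : Fin d → 𝔰𝔲(N)`, `8‖A‖ ≤ a`; `X` on the polydisc `100ℓ(e^{‖X‖} − 1) ≤ ρ` with `8‖Ad_h X − A∘dir‖ ≤ a`:
   **`‖↑(ψ_{U₀}(X)c) − ↑((Dψ_{U₀}(0)X)c)‖ ≤ 8B‖Ad_h X − A∘dir‖²∕(a−‖A‖)² + 32B‖Ad_h X − A∘dir‖‖A‖∕a² + (ℓ‖A‖)³ + 8·(67ℓ·((d−1)·2L·δ))·‖X‖²∕a²`**, `B = 54ℓ(e^a − 1)` — the ORIGINAL pair,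
   no `κ`, no gauge letter; the oscillation is read in the axial gauge (`OSC_h`; door (γ) C₃ ✓`norm_conjField_sub_le` converts it at the price `2·sup dist1(h)·‖X‖` where wanted).
WHAT IS STILL THE CONSUMER's: pricing `OSC_h` (OSC-LIFT ✓p835228 + (γ)); the bound on the gauge function itself (`sup dist1 (h x) ≤ 2σ_t + C·L·θ_t` from the lane's stage-axial bond
smallness) if the raw oscillation is preferred; the sizes∕windows of the tower (c₁ core ∕ G4-i).

HONEST.  Torus∕box bookkeeping over landed engines (lit `T4AxialGaugeSmallField`, N18 `inBox_rel_of_twoBlock`, C₂, C₃); nothing of Bałaban's analysis is asserted or proved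
([Balaban1985Averaging] pp.24–25 «|V₀,b − 1| < |b₋ − y|α₀», Prop. 3∕4 are cited as SOURCES); OSC pricing, rows' `R`∕`ε`, budgets, (E5), (ST‴), (SCT″-c)₁₂₃, LOC‴, GAP♯∘
(`stub_uniformFibreGapOrbit`, registry 3732b7df UNTOUCHED, 0∕5), the five REGISTERED stubs, S2β, crux 20520, 19936, 19200, `YM3TorusSU2` — NOT proved; no summit statement is proved by a
helper; rung R3 = SU(2) YM₃ on T³ at fixed lattice data — NOT d = 4, NOT infinite volume, NOT a mass gap, NOT Clay; the Yang–Mills mass gap is NOT proved.  Axioms standard.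

References: [Balaban1985Averaging] T. Bałaban, CMP **98** (1985) 17–51, (11)–(13) p.19, pp.24–25, Prop. 3 (121)–(125) p.36, Prop. 4 (148)–(149) p.40; [Balaban1985UV3] CMP **102**
(1985) 255–275, (27) p.263; [Balaban1987RG1] CMP **109** (1987) 249–301, (0.1)–(0.4) pp.251–253.
-/

set_option autoImplicit false

noncomputable section

open scoped Matrix.Norms.L2Operator Topology
open Filter Set Function Metric

namespace Summit.QuantumFields.YangMills.Theorems.FluctuationComparisonRegPrIntLS2BetaChartReadCurvedOfPlaqSmall

open Literature.MathematicalPhysics.QuantumFieldTheory.Balaban1983to89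
open Literature.MathematicalPhysics.QuantumFieldTheory.Balaban1983to89.HaarExponentialChart
open Literature.MathematicalPhysics.QuantumFieldTheory.Balaban1983to89.HaarExponentialChart.IsChartRep
open Literature.MathematicalPhysics.QuantumFieldTheory.Balaban1983to89.BlockAveraging (Small Idx avgFun loopHol off corr)
open Literature.MathematicalPhysics.QuantumFieldTheory.Balaban1983to89.ExpMeanLog (eml expMeanLogSU deltaSU deltaSU_pos)
open Literature.MathematicalPhysics.QuantumFieldTheory.Balaban1983to89.Node00
open Literature.MathematicalPhysics.QuantumFieldTheory.Balaban1983to89.T4Continuum (walk holAt LStep loopWord)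
open Literature.MathematicalPhysics.QuantumFieldTheory.Balaban1983to89.B10Eq27TorusAxialLog (rel transl transl_apply transl_rel)
open Literature.MathematicalPhysics.QuantumFieldTheory.Balaban1983to89.B7Prop1Local (InBox)
open Literature.MathematicalPhysics.QuantumFieldTheory.Balaban1983to89.T4AxialGaugeSmallField (castSite castSite_apply boxBonds boxPlaqs axialGauge dist1_gaugeAct_axialGauge_le_of_mem_boxBonds)
open Summit.QuantumFields.YangMills.BalabanUVNodes.N09ChartReadAveragingSmooth
open Summit.QuantumFields.YangMills.BalabanUVNodes.N09CentralWindowInjective (norm_coe_SU_le_one)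
open Summit.QuantumFields.YangMills.Theorems.FluctuationComparisonRegPrIntLS2BetaCovWalkSumStokes (norm_coe_conj_le)
open Summit.QuantumFields.YangMills.Theorems.FluctuationComparisonRegPrIntLS2BetaChartReadBkgLipschitz (norm_chartRead_sub_fderiv_le_curved_osc)
open Summit.QuantumFields.YangMills.Theorems.FluctuationComparisonRegPrIntLS2BetaChartReadGaugeCovariance
open YMDAG.N18.TransportOfRecord (inBox_rel_of_twoBlock two_mul_sq_le_sitesPerDir)

variable {P : Params} {j : ℕ} {N : ℕ} [NeZero N]

/-! ## §1 The bonds issuing from `B(c₋) ∪ B(c₊)` lie in the non-wrapping integer box `[emb c₋ − h, emb c₋ + h + L·e_μ + 1]` (`h = (L−1)∕2`, `j + 2 ≤ m + K`) -/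

section Box

omit [NeZero N] in
/-- ★ **THE TWO-BLOCK BONDS ARE BOX BONDS**: every bond issuing from `B(c₋) ∪ B(c₊)` is `⟨castSite x, μ⟩` with `lo ≤ x`, `x + e_μ ≤ hi` for the integer box `lo = emb c₋ − h`,
`hi = emb c₋ + h + L·e_{c.dir} + 1` (`h = (L−1)∕2`; `x = emb c₋ + rel (emb c₋) b₋`, N18 ✓`inBox_rel_of_twoBlock`). [cite: Balaban1987RG1, (0.1), (0.3) pp.251-252] -/
theorem mem_boxBonds_of_blockOf_src (hj : j + 1 ≤ P.m + P.K) (hj2 : j + 2 ≤ P.m + P.K) (c : PBond P (j + 1)) (b : PBond P j)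
    (hb : blockOf b.src = c.src ∨ blockOf b.src = c.tgt) :
    b ∈ boxBonds (fun κ : Fin P.d => (((emb c.src κ).val : ℕ) : ℤ) - (((P.L - 1) / 2 : ℕ) : ℤ)) (fun κ : Fin P.d => (((emb c.src κ).val : ℕ) : ℤ) + ((if c.dir = κ then (P.L : ℤ) else 0) + (((P.L - 1) / 2 : ℕ) : ℤ)) + 1) := by
  have hbox := inBox_rel_of_twoBlock hj hj2 c hb
  refine ⟨fun κ => (((emb c.src κ).val : ℕ) : ℤ) + rel (emb c.src) b.src κ, ?_, ?_, ?_⟩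
  · intro κ
    have h1 := (hbox κ).1
    dsimp only at h1 ⊢
    linarith
  · intro κ
    have h2 := (hbox κ).2
    have hL0 : (0 : ℤ) ≤ (P.L : ℤ) := by positivity
    simp only [Pi.add_apply, B7Prop1Explicit.e_apply] at h2 ⊢
    split_ifs at h2 ⊢ <;> linarith
  · funext κ
    rw [castSite_apply, Int.cast_add, Int.cast_natCast, ZMod.natCast_zmod_val, ← transl_apply, transl_rel]

omit [NeZero N] in
/-- The box has `2L + 1` sites per direction (`hi ≤ lo + 2L`, `2h + 1 = L`). [folklore] -/
theorem hi_le_lo_add (c : PBond P (j + 1)) (κ : Fin P.d) :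
    (fun κ : Fin P.d => (((emb c.src κ).val : ℕ) : ℤ) + ((if c.dir = κ then (P.L : ℤ) else 0) + (((P.L - 1) / 2 : ℕ) : ℤ)) + 1) κ ≤ (fun κ : Fin P.d => (((emb c.src κ).val : ℕ) : ℤ) - (((P.L - 1) / 2 : ℕ) : ℤ)) κ + ((2 * P.L : ℕ) : ℤ) := by
  have hL : (2 : ℤ) * (((P.L - 1) / 2 : ℕ) : ℤ) + 1 = P.L := by exact_mod_cast AveragingRT.two_mul_half_add_one P
  have h2L : ((2 * P.L : ℕ) : ℤ) = 2 * (P.L : ℤ) := by norm_num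
  rw [h2L]
  dsimp only
  split_ifs <;> linarith

omit [NeZero N] in
/-- The box does not wrap: `2L < sitesPerDir j` when `j + 2 ≤ m + K` (`2L < 2L² ≤ sitesPerDir j`). [folklore] -/
theorem two_mul_lt_sitesPerDir (hj2 : j + 2 ≤ P.m + P.K) : 2 * P.L < P.sitesPerDir j := by
  have h := two_mul_sq_le_sitesPerDir (P := P) hj2
  have hL : 2 ≤ P.L := P.hL.2
  have : 2 * P.L < 2 * P.L ^ 2 := by nlinarith
  omega

/-- ★ **THE AXIAL-GAUGE COPY OF A PLAQUETTE-SMALL BACKGROUND IS `(d−1)·2L·δ`-CLOSE TO `1` ON THE BONDS ISSUING FROM `B(c₋) ∪ B(c₊)`** (lit ✓`T4AxialGaugeSmallField`'s torus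
non-abelian Poincaré lemma on the two-block box). [cite: Balaban1985Averaging, pp.24-25; Balaban1985UV3, (27) p.263] -/
theorem norm_coe_gaugeAct_axialGauge_sub_one_le (hj : j + 1 ≤ P.m + P.K) (hj2 : j + 2 ≤ P.m + P.K) (U₀ : GaugeField P j (SU N)) {δ : ℝ} (hδ : 0 ≤ δ)
    (hU : PlaqSmall δ U₀) (c : PBond P (j + 1)) (b : PBond P j) (hb : blockOf b.src = c.src ∨ blockOf b.src = c.tgt) :
    ‖((GaugeField.gaugeAct (T4AxialGaugeSmallField.axialGauge U₀ (fun κ : Fin P.d => (((emb c.src κ).val : ℕ) : ℤ) - (((P.L - 1) / 2 : ℕ) : ℤ)) (fun κ : Fin P.d => (((emb c.src κ).val : ℕ) : ℤ) + ((if c.dir = κ then (P.L : ℤ) else 0) + (((P.L - 1) / 2 : ℕ) : ℤ)) + 1)) U₀ b : SU N) : Matrix (Fin N) (Fin N) ℂ) - 1‖ ≤ ((P.d - 1 : ℕ) : ℝ) * ((2 * P.L : ℕ) : ℝ) * δ := by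
  have hS₀ : boxPlaqs (fun κ : Fin P.d => (((emb c.src κ).val : ℕ) : ℤ) - (((P.L - 1) / 2 : ℕ) : ℤ)) (fun κ : Fin P.d => (((emb c.src κ).val : ℕ) : ℤ) + ((if c.dir = κ then (P.L : ℤ) else 0) + (((P.L - 1) / 2 : ℕ) : ℤ)) + 1) ⊆ (Set.univ : Set (Plaq P j)) := Set.subset_univ _
  have hU' : PlaqSmallOn (Set.univ : Set (Plaq P j)) δ U₀ := fun p _ => hU p
  have h := dist1_gaugeAct_axialGauge_le_of_mem_boxBonds U₀ hS₀ hU' hδ (hi_le_lo_add (P := P) c) (two_mul_lt_sitesPerDir (P := P) hj2)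
    (mem_boxBonds_of_blockOf_src hj hj2 c b hb)
  exact h

end Box

/-! ## §2 ★★★ (β-3)′ AT A PLAQUETTE-SMALL BACKGROUND — door (α) docked through C₃'s gauge invariance of the remainder norm -/

section Main

/-- ★★★ **(β-3)′ AT A PLAQUETTE-SMALL BACKGROUND, NO GAUGE HYPOTHESIS.**  For `U₀` in the loop `α`-guard at every coarse bond (`4α ≤ ρ ≤ innerRadius`, `0 < ρ`) with `PlaqSmall δ U₀`,
`100ℓ·((d−1)·2L·δ) ≤ ρ`, `j + 2 ≤ m + K`; `h` = the two-block AXIAL GAUGE of `U₀` at `c` (lit ✓`T4AxialGaugeSmallField.axialGauge` on the box `[emb c₋ − h, emb c₋ + h + L·e_μ + 1]`);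
a radius `0 < a`, `100ℓ(e^a − 1) ≤ ρ`; direction data `A : Fin d → 𝔰𝔲(N)`, `8‖A‖ ≤ a`; and a direction `X` on the polydisc `100ℓ(e^{‖X‖} − 1) ≤ ρ` whose GAUGED oscillation about
the direction-constant field is small, `8‖Ad_h X − A∘dir‖ ≤ a`:
`‖↑(ψ_{U₀}(X)c) − ↑((Dψ_{U₀}(0)X)c)‖ ≤ 8B‖Ad_h X − A∘dir‖²∕(a−‖A‖)² + 32B‖Ad_h X − A∘dir‖‖A‖∕a² + (ℓ‖A‖)³ + 8·(67ℓ·((d−1)·2L·δ))·‖X‖²∕a²`, `B = 54ℓ(e^a − 1)`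
(C₃ ✓`norm_chartRead_sub_fderiv_gaugeAct` + C₂ ✓`norm_chartRead_sub_fderiv_le_curved_osc` at `(h•U₀, Ad_h X)` + §1; the loop guard is gauge invariant, `‖Ad_h X‖ ≤ ‖X‖`).
[cite: Balaban1985Averaging, (11)-(13) p.19, pp.24-25, Prop. 3 (121)-(125) p.36, Prop. 4 (148)-(149) p.40; Balaban1987RG1, (0.3)-(0.4) pp.252-253] -/
theorem norm_chartRead_sub_fderiv_le_of_plaqSmall (hj2 : j + 2 ≤ P.m + P.K) (U₀ : GaugeField P j (SU N)) {α ρ : ℝ} (hρ0 : 0 < ρ)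
    (hρ : ρ ≤ innerRadius (specialUnitaryLogChart (Fin N))) (hα : ∀ c i, dist1 (loopHol U₀ c i) ≤ α) (hα4 : 4 * α ≤ ρ)
    {δ : ℝ} (hδ : 0 ≤ δ) (hU : PlaqSmall δ U₀) (hκℓ : 100 * ((((P.d + 2) * P.L : ℕ) : ℝ) * (((P.d - 1 : ℕ) : ℝ) * ((2 * P.L : ℕ) : ℝ) * δ)) ≤ ρ) (c : PBond P (j + 1))
    {a : ℝ} (ha0 : 0 < a) (ha : 100 * ((((P.d + 2) * P.L : ℕ) : ℝ) * (Real.exp a - 1)) ≤ ρ)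
    (A : Fin P.d → (specialUnitaryLogChart (Fin N)).lie) (hAa : 8 * ‖A‖ ≤ a)
    (X : PBond P j → (specialUnitaryLogChart (Fin N)).lie) (hX : 100 * ((((P.d + 2) * P.L : ℕ) : ℝ) * (Real.exp ‖X‖ - 1)) ≤ ρ)
    (hXA : 8 * ‖(fun b : PBond P j => (⟨(((T4AxialGaugeSmallField.axialGauge U₀ (fun κ : Fin P.d => (((emb c.src κ).val : ℕ) : ℤ) - (((P.L - 1) / 2 : ℕ) : ℤ)) (fun κ : Fin P.d => (((emb c.src κ).val : ℕ) : ℤ) + ((if c.dir = κ then (P.L : ℤ) else 0) + (((P.L - 1) / 2 : ℕ) : ℤ)) + 1)) b.src : SU N) : Matrix (Fin N) (Fin N) ℂ) * ((X b : (specialUnitaryLogChart (Fin N)).lie) : Matrix (Fin N) (Fin N) ℂ) * star (((T4AxialGaugeSmallField.axialGauge U₀ (fun κ : Fin P.d => (((emb c.src κ).val : ℕ) : ℤ) - (((P.L - 1) / 2 : ℕ) : ℤ)) (fun κ : Fin P.d => (((emb c.src κ).val : ℕ) : ℤ) + ((if c.dir = κ then (P.L : ℤ) else 0) + (((P.L -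 1) / 2 : ℕ) : ℤ)) + 1)) b.src : SU N) : Matrix (Fin N) (Fin N) ℂ), conj_mem_lie ((T4AxialGaugeSmallField.axialGauge U₀ (fun κ : Fin P.d => (((emb c.src κ).val : ℕ) : ℤ) - (((P.L - 1) / 2 : ℕ) : ℤ)) (fun κ : Fin P.d => (((emb c.src κ).val : ℕ) : ℤ) + ((if c.dir = κ then (P.L : ℤ) else 0) + (((P.L - 1) / 2 : ℕ) : ℤ)) + 1)) b.src) (X b)⟩ : (specialUnitaryLogChart (Fin N)).lie)) - (fun b => A b.dir)‖ ≤ a) :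
    ‖(((isChartRep_specialUnitaryGroup (n := Fin N)).logChart (avgFun (expMeanLogSU (n := Fin N)) (fun b => (isChartRep_specialUnitaryGroup (n := Fin N)).expChart (X b) * U₀ b) c * (avgFun (expMeanLogSU (n := Fin N)) U₀ c)⁻¹) : (specialUnitaryLogChart (Fin N)).lie) : Matrix (Fin N) (Fin N) ℂ) -
        (((fderiv ℝ (fun (A : PBond P j → (specialUnitaryLogChart (Fin N)).lie) (c : PBond P (j + 1)) => (isChartRep_specialUnitaryGroup (n := Fin N)).logChart (avgFun (expMeanLogSU (n := Fin N)) (fun b => (isChartRep_specialUnitaryGroup (n := Fin N)).expChart (A b) * U₀ b) c * (avgFun (expMeanLogSU (n := Fin N)) U₀ c)⁻¹)) 0 X) c : (specialUnitaryLogChart (Fin N)).lie) : Matrix (Fin N) (Fin N) ℂ)‖ ≤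
      8 * (54 * ((((P.d + 2) * P.L : ℕ) : ℝ) * (Real.exp a - 1))) * ‖(fun b : PBond P j => (⟨(((T4AxialGaugeSmallField.axialGauge U₀ (fun κ : Fin P.d => (((emb c.src κ).val : ℕ) : ℤ) - (((P.L - 1) / 2 : ℕ) : ℤ)) (fun κ : Fin P.d => (((emb c.src κ).val : ℕ) : ℤ) + ((if c.dir = κ then (P.L : ℤ) else 0) + (((P.L - 1) / 2 : ℕ) : ℤ)) + 1)) b.src : SU N) : Matrix (Fin N) (Fin N) ℂ) * ((X b : (specialUnitaryLogChart (Fin N)).lie) : Matrix (Fin N) (Fin N) ℂ) * star (((T4AxialGaugeSmallField.axialGauge U₀ (fun κ : Fin P.d => (((emb c.src κ).val : ℕ) : ℤ) - (((P.L - 1) / 2 : ℕ) : ℤ)) (fun κ : Fin P.d => (((emb c.src κ).val : ℕ) : ℤ) + ((if c.dir = κ then (P.L : ℤ) else 0) + (((P.L - 1) / 2 : ℕ) : ℤ)) + 1)) b.src : SU N) : Matrix (Fin N) (Fin N) ℂ), conj_mem_lie ((T4AxialGaugeSmallField.axialGauge U₀ (fun κ : Fin P.d => (((emb c.src κ).val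 : ℕ) : ℤ) - (((P.L - 1) / 2 : ℕ) : ℤ)) (fun κ : Fin P.d => (((emb c.src κ).val : ℕ) : ℤ) + ((if c.dir = κ then (P.L : ℤ) else 0) + (((P.L - 1) / 2 : ℕ) : ℤ)) + 1)) b.src) (X b)⟩ : (specialUnitaryLogChart (Fin N)).lie)) - (fun b => A b.dir)‖ ^ 2 / (a - ‖A‖) ^ 2 +
        32 * (54 * ((((P.d + 2) * P.L : ℕ) : ℝ) * (Real.exp a - 1))) * ‖(fun b : PBond P j => (⟨(((T4AxialGaugeSmallField.axialGauge U₀ (fun κ : Fin P.d => (((emb c.src κ).val : ℕ) : ℤ) - (((P.L - 1) / 2 : ℕ) : ℤ)) (fun κ : Fin P.d => (((emb c.src κ).val : ℕ) : ℤ) + ((if c.dir = κ then (P.L : ℤ) else 0) + (((P.L - 1) / 2 : ℕ) : ℤ)) + 1)) b.src : SU N) : Matrix (Fin N) (Fin N) ℂ) * ((X b : (specialUnitaryLogChart (Fin N)).lie) : Matrix (Fin N) (Fin N) ℂ) * star (((T4AxialGaugeSmallField.axialGauge U₀ (fun κ : Fin P.d => (((emb c.src κ).val : ℕ) : ℤ)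 - (((P.L - 1) / 2 : ℕ) : ℤ)) (fun κ : Fin P.d => (((emb c.src κ).val : ℕ) : ℤ) + ((if c.dir = κ then (P.L : ℤ) else 0) + (((P.L - 1) / 2 : ℕ) : ℤ)) + 1)) b.src : SU N) : Matrix (Fin N) (Fin N) ℂ), conj_mem_lie ((T4AxialGaugeSmallField.axialGauge U₀ (fun κ : Fin P.d => (((emb c.src κ).val : ℕ) : ℤ) - (((P.L - 1) / 2 : ℕ) : ℤ)) (fun κ : Fin P.d => (((emb c.src κ).val : ℕ) : ℤ) + ((if c.dir = κ then (P.L : ℤ) else 0) + (((P.L - 1) / 2 : ℕ) : ℤ)) + 1)) b.src) (X b)⟩ : (specialUnitaryLogChart (Fin N)).lie)) - (fun b => A b.dir)‖ * ‖A‖ / a ^ 2 +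
        ((((P.d + 2) * P.L : ℕ) : ℝ) * ‖A‖) ^ 3 + 8 * (67 * ((((P.d + 2) * P.L : ℕ) : ℝ) * (((P.d - 1 : ℕ) : ℝ) * ((2 * P.L : ℕ) : ℝ) * δ))) * ‖X‖ ^ 2 / a ^ 2 := by
  have hj : j + 1 ≤ P.m + P.K := by omega
  set h : GaugeTransf P j (SU N) := (T4AxialGaugeSmallField.axialGauge U₀ (fun κ : Fin P.d => (((emb c.src κ).val : ℕ) : ℤ) - (((P.L - 1) / 2 : ℕ) : ℤ)) (fun κ : Fin P.d => (((emb c.src κ).val : ℕ) : ℤ) + ((if c.dir = κ then (P.L : ℤ) else 0) + (((P.L - 1) / 2 : ℕ) : ℤ)) + 1)) with hh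
  -- the remainder's norm is gauge invariant (C₃)
  rw [← norm_chartRead_sub_fderiv_gaugeAct h U₀ hj hρ0 hρ hα hα4 X c hX]
  -- hypotheses of C₂ at the gauge copy
  have hα' : ∀ c' i, dist1 (loopHol (GaugeField.gaugeAct h U₀) c' i) ≤ α := fun c' i => by
    rw [dist1_loopHol_gaugeAct]; exact hα c' i
  have hκ : ∀ b : PBond P j, (blockOf b.src = c.src ∨ blockOf b.src = c.tgt) →
      ‖((GaugeField.gaugeAct h U₀ b : SU N) : Matrix (Fin N) (Fin N) ℂ) - 1‖ ≤ ((P.d - 1 : ℕ) : ℝ) * ((2 * P.L : ℕ) : ℝ) * δ := fun b hb => by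
    rw [hh]; exact norm_coe_gaugeAct_axialGauge_sub_one_le hj hj2 U₀ hδ hU c b hb
  have hXh : ‖(fun b : PBond P j => (⟨((h b.src : SU N) : Matrix (Fin N) (Fin N) ℂ) * ((X b : (specialUnitaryLogChart (Fin N)).lie) : Matrix (Fin N) (Fin N) ℂ) * star ((h b.src : SU N) : Matrix (Fin N) (Fin N) ℂ), conj_mem_lie (h b.src) (X b)⟩ : (specialUnitaryLogChart (Fin N)).lie))‖ ≤ ‖X‖ := by
    refine (pi_norm_le_iff_of_nonneg (norm_nonneg X)).2 fun b => ?_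
    rw [← Submodule.norm_coe]
    exact (norm_coe_conj_le (h b.src) _).trans (by rw [Submodule.norm_coe]; exact norm_le_pi_norm X b)
  have hC := norm_chartRead_sub_fderiv_le_curved_osc (GaugeField.gaugeAct h U₀) hj hρ0 hρ hα' hα4 hκℓ c hκ ha0 ha A hAa (fun b : PBond P j => (⟨((h b.src : SU N) : Matrix (Fin N) (Fin N) ℂ) * ((X b : (specialUnitaryLogChart (Fin N)).lie) : Matrix (Fin N) (Fin N) ℂ) * star ((h b.src : SU N) : Matrix (Fin N) (Fin N) ℂ), conj_mem_lie (h b.src) (X b)⟩ : (specialUnitaryLogChart (Fin N)).lie)) hXA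
  refine hC.trans ?_
  have hcoef : 0 ≤ 8 * (67 * ((((P.d + 2) * P.L : ℕ) : ℝ) * (((P.d - 1 : ℕ) : ℝ) * ((2 * P.L : ℕ) : ℝ) * δ))) := by positivity
  have hsq : ‖(fun b : PBond P j => (⟨((h b.src : SU N) : Matrix (Fin N) (Fin N) ℂ) * ((X b : (specialUnitaryLogChart (Fin N)).lie) : Matrix (Fin N) (Fin N) ℂ) * star ((h b.src : SU N) : Matrix (Fin N) (Fin N) ℂ), conj_mem_lie (h b.src) (X b)⟩ : (specialUnitaryLogChart (Fin N)).lie))‖ ^ 2 ≤ ‖X‖ ^ 2 := pow_le_pow_left₀ (norm_nonneg _) hXh 2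
  have hlast : 8 * (67 * ((((P.d + 2) * P.L : ℕ) : ℝ) * (((P.d - 1 : ℕ) : ℝ) * ((2 * P.L : ℕ) : ℝ) * δ))) * ‖(fun b : PBond P j => (⟨((h b.src : SU N) : Matrix (Fin N) (Fin N) ℂ) * ((X b : (specialUnitaryLogChart (Fin N)).lie) : Matrix (Fin N) (Fin N) ℂ) * star ((h b.src : SU N) : Matrix (Fin N) (Fin N) ℂ), conj_mem_lie (h b.src) (X b)⟩ : (specialUnitaryLogChart (Fin N)).lie))‖ ^ 2 / a ^ 2 ≤
      8 * (67 * ((((P.d + 2) * P.L : ℕ) : ℝ) * (((P.d - 1 : ℕ) : ℝ) * ((2 * P.L : ℕ) : ℝ) * δ))) * ‖X‖ ^ 2 / a ^ 2 :=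
    div_le_div_of_nonneg_right (mul_le_mul_of_nonneg_left hsq hcoef) (pow_pos ha0 2).le
  linarith

end Main

end Summit.QuantumFields.YangMills.Theorems.FluctuationComparisonRegPrIntLS2BetaChartReadCurvedOfPlaqSmall

end
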